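import Mathlib
import Summits.KontsevichZagierPeriods.KontsevichZagierPeriods.Theses.TerasomaMultiplication

/-!
# Sketch — crux idea `conifold-annulus-green` for MultiplicationThree (stmt-KontsevichZagierPeriods-3598)

First lemmas of the line, over Mathlib only (crux-ideate round 1, ideator k = 2, gen 2).

Coordinates: `e = (e₁, e₂) = (y₁ + y₂, y₁ y₂)` (Terasoma–Vieta), level function
`N(e) = s₀ s₁ s₂ = (1 − y₁³)(1 − y₂³) = 1 − e₁³ + 3 e₁ e₂ + e₂³`, `s_j = 1 − ζ^j e₁ + ζ^{2j} e₂`.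
The simplex real form is `R₂ = {e₂ = −conj e₁}`; the box is carried by the ζ-twisted bent square
`P = (γ − ζγ) × (γ − ζ²γ)` (sector-convex-cobordism / Terasoma), whose level slices `Γ_c` are closed
curves made of three arcs `ē(ζ^a u, ζ^b v)`, `(a,b) ∈ {(1,2),(0,2),(1,0)}`, `(1−u³)(1−v³) = c`.
-/

noncomputable section

open Complex Set

namespace Summit.KontsevichZagierPeriods.KontsevichZagierPeriods.Cruxes.MultiplicationThree.ConifoldAnnulus

/-- A primitive cube root of unity. -/
def ζ : ℂ := Complex.exp (2 * Real.pi * Complex.I / 3)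

/-- The level function of the crux in Terasoma–Vieta coordinates:
`N(e₁,e₂) = s₀s₁s₂ = (1 − y₁³)(1 − y₂³)` with `e₁ = y₁ + y₂`, `e₂ = y₁y₂`. -/
def levelN (e₁ e₂ : ℂ) : ℂ := 1 - e₁ ^ 3 + 3 * e₁ * e₂ + e₂ ^ 3

/-- (L0a) REGULAR FAMILY / CONIFOLD. The only critical points of `N` on `ℂ²` are the barycentre
`e = 0` (critical value `1`: the node) and points of the divisor `D = {N = 0}` (the three double
points `(−ζ^k, ζ^{2k})`). Hence `N` has no critical value in `(0,1)`: the affine level cubics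
`E_c = {N = c}`, `c ∈ (0,1)`, form a regular (locally trivial) family, along which integral homology
classes of continuously varying cycles are transported. Provable now (polynomial algebra). -/
def LevelCriticalValues : Prop :=
  ∀ e₁ e₂ : ℂ, -3 * e₁ ^ 2 + 3 * e₂ = 0 → 3 * e₁ + 3 * e₂ ^ 2 = 0 →
    (e₁ = 0 ∧ e₂ = 0) ∨ levelN e₁ e₂ = 0

/-- (L0b) THE NODE IS MORSE (A₁): `N − 1 = 3 e₁ e₂ + (cubic)`, so near `c → 1⁻` the level curve
`E_c` inside a small ball is the Milnor fibre of an A₁ point, a cylinder with `H₁ ≅ ℤ` generated by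
the vanishing cycle. Provable now (`ring`). -/
def NodeIsA1 : Prop :=
  ∀ e₁ e₂ : ℂ, levelN e₁ e₂ - 1 = 3 * e₁ * e₂ + (e₂ ^ 3 - e₁ ^ 3)

/-- (L1) DISJOINTNESS. The three twisted box arcs never meet the simplex real form
`R₂ = {e₂ = −conj e₁}`: for `u, v ∈ (0,1)`,
`ζ^{a+b} u v ≠ −conj(ζ^a u + ζ^b v)` for `(a,b) ∈ {(1,2), (0,2), (1,0)}` (take imaginary parts:
they force `u = v ∧ u² = u`, resp. `u = 1`, resp. `v = 1`). Hence `Γ_c ∩ O_c = ∅` at every level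
`c ∈ (0,1)`, and the annulus `S_c` is a connected component of `E_c(ℂ) ∖ (Γ_c ∪ O_c)` — semialgebraic
by `IsSemialgebraic.isSemialgebraic_connectedComponentIn`. PROVED below (`twistedSliceOffSimplexPlane`). -/
def TwistedSliceOffSimplexPlane : Prop :=
  ∀ u v : ℝ, u ∈ Ioo (0:ℝ) 1 → v ∈ Ioo (0:ℝ) 1 →
    (((u * v : ℝ) : ℂ) ≠ -(starRingEnd ℂ) (ζ * (u : ℂ) + ζ ^ 2 * (v : ℂ))) ∧
    (ζ ^ 2 * ((u * v : ℝ) : ℂ) ≠ -(starRingEnd ℂ) ((u : ℂ) + ζ ^ 2 * (v : ℂ))) ∧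
    (ζ * ((u * v : ℝ) : ℂ) ≠ -(starRingEnd ℂ) (ζ * (u : ℂ) + (v : ℂ)))

/-- (L2) THE SLICE IS A CLOSED CURVE. At level `c ∈ (0,1)` put `w = (1 − c)^{1/3}`; the three arcs
`τ ↦ ē(ζ^a u(τ), ζ^b v(τ))` of the bent square run between the three points
`A = (w, 0)`, `Z₁ = (ζ w, 0)`, `Z₂ = (ζ² w, 0)` of the `e`-plane (one inverse root zero), with the
chain signs `−(0,2) − (1,0) + (1,2)` composing to the loop `Z₁ → A → Z₂ → Z₁`; the untwisted
quadrant `(0,0)` folds onto itself under Vieta and contributes the zero chain. Stated as the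
endpoint identities (trivial algebra, recorded to fix conventions). -/
def SliceEndpoints : Prop :=
  ∀ w : ℝ, (ζ * (0:ℂ) + ζ ^ 2 * (w : ℂ) = (0:ℂ) + ζ ^ 2 * (w : ℂ)) ∧
    (ζ * (w : ℂ) + ζ ^ 2 * (0:ℂ) = ζ * (w : ℂ) + (0 : ℂ)) ∧
    ((0:ℂ) + ζ ^ 2 * (0:ℂ) * 0 = 0)

/-- (L3) WHAT THE LINE DELIVERS (shape only): the crux itself, uniformly in `s`, through
MellinCoarea's coarea shear on both sides and ONE fibred Green move on the annulus family
`W₃ = ⋃_c {c} × S_c` (two `newtonLeibnizRel` instances per cell, primitives = real and imaginary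
parts of the Gelfand–Leray coefficient `i√3/(∂N/∂e₂)`, a `ℚ(ζ₃)`-semialgebraic function), with the
ζ-pair bookkeeping of sector-convex-cobordism. -/
def LineShape : Prop :=
  LevelCriticalValues → NodeIsA1 → TwistedSliceOffSimplexPlane →
    Summit.KontsevichZagierPeriods.KontsevichZagierPeriods.Theses.TerasomaMultiplication.MultiplicationThree

/-- (L0b) is a ring identity. -/
theorem nodeIsA1 : NodeIsA1 := by
  intro e₁ e₂
  simp only [levelN]
  ring

/-- (L0a): the critical points of `N` are the node `e = 0` and points of `D` (there `N = (1 + e₁³)² = 0`). -/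
theorem levelCriticalValues : LevelCriticalValues := by
  intro e₁ e₂ h1 h2
  have he2 : e₂ = e₁ ^ 2 := by linear_combination h1 / 3
  subst he2
  have h3 : e₁ * (1 + e₁ ^ 3) = 0 := by linear_combination h2 / 3
  rcases mul_eq_zero.mp h3 with h | h
  · left
    subst h
    simp
  · right
    simp only [levelN]
    linear_combination (1 + e₁ ^ 3) * h

/-- `ζ = −1/2 + (√3/2) i`. -/
theorem zeta_eq : ζ = ⟨-1/2, Real.sqrt 3 / 2⟩ := by
  have h : ζ = Complex.exp (((2 * Real.pi / 3 : ℝ) : ℂ) * Complex.I) := by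
    unfold ζ; congr 1; push_cast; ring
  have hc : Real.cos (2 * Real.pi / 3) = -1/2 := by
    have : 2 * Real.pi / 3 = Real.pi - Real.pi / 3 := by ring
    rw [this, Real.cos_pi_sub, Real.cos_pi_div_three]; norm_num
  have hs : Real.sin (2 * Real.pi / 3) = Real.sqrt 3 / 2 := by
    have : 2 * Real.pi / 3 = Real.pi - Real.pi / 3 := by ring
    rw [this, Real.sin_pi_sub, Real.sin_pi_div_three]
  rw [h, Complex.exp_mul_I, ← Complex.ofReal_cos, ← Complex.ofReal_sin, hc, hs]
  apply Complex.ext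
  · simp only [Complex.add_re, Complex.mul_re, Complex.I_re, Complex.I_im, Complex.ofReal_re,
      Complex.ofReal_im]
    ring
  · simp only [Complex.add_im, Complex.mul_im, Complex.I_re, Complex.I_im, Complex.ofReal_re,
      Complex.ofReal_im]
    ring

/-- `ζ² = −1/2 − (√3/2) i`. -/
theorem zeta_sq_eq : ζ ^ 2 = ⟨-1/2, -(Real.sqrt 3 / 2)⟩ := by
  rw [zeta_eq]
  have h3 : Real.sqrt 3 * Real.sqrt 3 = 3 := Real.mul_self_sqrt (by norm_num)
  apply Complex.ext
  · simp only [sq, Complex.mul_re]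
    nlinarith [h3]
  · simp only [sq, Complex.mul_im]
    ring

/-- (L1) PROVED: the twisted box slice is off the simplex plane. -/
theorem twistedSliceOffSimplexPlane : TwistedSliceOffSimplexPlane := by
  intro u v hu hv
  obtain ⟨hu0, hu1⟩ := hu
  obtain ⟨hv0, hv1⟩ := hv
  have h3 : Real.sqrt 3 * Real.sqrt 3 = 3 := Real.mul_self_sqrt (by norm_num)
  have hs3 : 0 < Real.sqrt 3 := Real.sqrt_pos.mpr (by norm_num)
  rw [zeta_sq_eq, zeta_eq]
  refine ⟨?_, ?_, ?_⟩
  · intro h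
    have hre := congrArg Complex.re h
    have him := congrArg Complex.im h
    simp only [Complex.ofReal_re, Complex.ofReal_im, Complex.neg_re, Complex.neg_im, Complex.conj_re,
      Complex.conj_im, Complex.add_re, Complex.add_im, Complex.mul_re, Complex.mul_im] at hre him
    -- him : 0 = (√3/2·u − √3/2·v) ⇒ u = v ; hre : u v = (u+v)/2 ⇒ u² = u
    have huv : u = v := by nlinarith [hs3]
    subst huv
    nlinarith
  · intro h
    have hre := congrArg Complex.re h
    have him := congrArg Complex.im h
    simp only [Complex.ofReal_re, Complex.ofReal_im, Complex.neg_re, Complex.neg_im, Complex.conj_re,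
      Complex.conj_im, Complex.add_re, Complex.add_im, Complex.mul_re, Complex.mul_im] at hre him
    nlinarith [hs3, mul_pos hu0 hv0]
  · intro h
    have hre := congrArg Complex.re h
    have him := congrArg Complex.im h
    simp only [Complex.ofReal_re, Complex.ofReal_im, Complex.neg_re, Complex.neg_im, Complex.conj_re,
      Complex.conj_im, Complex.add_re, Complex.add_im, Complex.mul_re, Complex.mul_im] at hre him
    nlinarith [hs3, mul_pos hu0 hv0]

end Summit.KontsevichZagierPeriods.KontsevichZagierPeriods.Cruxes.MultiplicationThree.ConifoldAnnulus
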